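import Summits.Ventures.CertifiedManyBodySolver.Downfold.EmeryBoxesSLCOThermalCapRetiltBoxp1
import Summits.Ventures.CertifiedManyBodySolver.Downfold.EmeryBoxesSLCOThermalCapWord
import Summits.Ventures.CertifiedManyBodySolver.Downfold.EmeryThermalAtomicFloor
import HarnessLib

/-!
# HIGH-TEMPERATURE-CLOSING `T > 0` WINDOW on Sr0.9La0.1CuO2 #37/M37 cGW-SIC CLASS six-box (electron-doped) — `emeryBoxSLCOClass` (router/EMERY-FLOOR-ORDERS row 55): the ATOMIC-LIMIT floor (full entropy) ∨ the
# family floor, against the re-tilted cap — both sides meet at `6 log 2` as β → 0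

Venture CertifiedManyBodySolver, cell `pub/hubbard-downfold` (S1 = ROUTER) × crew hubbard-fast S2 (ii) × (iv) «T > 0 × multi-band» (D-0096 (ii)); seat hubbard-downfold-mod-4
(S1/S2 Emery seam, g17). Namespace `Summit.Ventures.CertifiedManyBodySolver.Downfold`. DOOR: `EmeryThermalAtomicFloor` (`holdsOn_emeryCellPressureAtomicFloor`: Peierls on the
whole occupation basis of the `Cu₄O₈` block, site-wise factorisation; the one-site function is the tree's `atomicPartitionFnReal β U μ`). INPUTS BY NAME: the family floor
`emeryBoxSLCOClass_pressureFloorFam_m59o5` (`EmeryBoxesSLCOThermalCapWord`; C = (-178.670811, -177.779858)), the cap `emeryBoxSLCOClass_pressureCap_m59o5_retilt` (`EmeryBoxesSLCOThermalCapRetiltBoxp1`; `6 log 2 + 48.3066·β`; flat word 49.9260).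
ATOMIC DATA: Cu at `μ_d = −(εp + Δ_hi) = 459/50`, `U_d,hi = 243/25`; O at `μ_p = −εp = 59/5`, `U_p,hi = 63/10` ⇒ classical slope 43.7800·β (family slope 44.6677; cap 48.3066).
RESULT: **`emeryBoxSLCOClass_pressureWindowHighT_m59o5`**: `max(atomic, family) ≤ P_cell ≤ 6 log 2 + 48.3066·β` on the whole box, every β ≥ 0; width → 0 as β → 0 (both sides `6 log 2`,
`emeryBoxSLCOClass_pressure_beta_zero_m59o5`); crossover β* ≈ 0.992 (T* ≈ 11700 K) below which the atomic floor is the better floor [float].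

Everything PROVED (0 sorry); no definition. HONEST FRAMING: CERTIFIED inequalities on a SCREENING/EXTRAPOLATED-grade object; the atomic floor ignores hopping (its slope sits
0.8877 below the family floor's), so at physical temperatures (β ≈ 20–40 eV⁻¹) the family floor still decides and thermal scales are NOT resolved there; what is new
is the correct INFINITE-TEMPERATURE closure of the window and a certified high-T regime (β ≲ β*) with width `≈ 4.5266·β`; grand-canonical at the stated level; no phase word;
no router number moves. WHAT-THIS-IS-NOT: a new certificate (pure algebra on landed objects; zero kit).
-/

noncomputable section

namespace Summit.Ventures.CertifiedManyBodySolver.Downfold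

open NonemptyInterval Matrix Finset Literature.Probability.LatticeModels
open Literature.MathematicalPhysics.QuantumLattice Literature.Computation.Certificates
open Summit.Ventures.CertifiedManyBodySolver.Certificates OccupationCode ClusterLowerBound
open scoped BigOperators ComplexOrder

/-! ## §1 The atomic-limit floor on the box at εp = -59/5 -/

/-- **ATOMIC-LIMIT `T > 0` FLOOR** on the whole `emeryBoxSLCOClass`, cuprate signs, level εp = -59/5 (chemical potential 59/5 eV), EVERY β ≥ 0:
`log z₀(β; U_d = 243/25, μ_d = 459/50) + 2·log z₀(β; U_p = 63/10, μ_p = 59/5) ≤ P_cell` with `z₀(β; U, μ) = 1 + 2e^{βμ} + e^{−β(U−2μ)}` (`atomicPartitionFnReal`; Cu at the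
box's upper level `εp + Δ_hi = -459/50` and `U_d,hi`, O at `εp` and `U_p,hi`). Value `6 log 2` at β = 0; slope `43.7800·β` as β → ∞ (classical minimum, no hopping).
[cite: Ruelle1969, §2.5–2.6] [cite: Ueltschi1999, §3] -/
theorem emeryBoxSLCOClass_pressureAtomicFloor_m59o5 {β : ℝ} (hβ : 0 ≤ β) :
    HoldsOn (fun p : EmeryCoord → ℝ => Real.log (atomicPartitionFnReal β (243/25 : ℝ) (459/50 : ℝ)) + 2 * Real.log (atomicPartitionFnReal β (63/10 : ℝ) (59/5 : ℝ)) ≤ emeryCellPressure β (emeryLine cuprateSigns (emeryLineCoords (((-59/5 : ℚ)) : ℝ) p))) emeryBoxSLCOClass := by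
  intro p hp
  have h := holdsOn_emeryCellPressureAtomicFloor (E := emeryBoxSLCOClass) (eA := slcoClassEmery_tpd) (eB := slcoClassEmery_tpp) (eD := slcoClassEmery_Delta) (eUd := slcoClassEmery_Udd) (eUp := slcoClassEmery_Upp) (-59/5) rfl rfl rfl rfl rfl cuprateSigns hβ p hp
  simp only [slcoClassEmery_Delta, slcoClassEmery_Udd, slcoClassEmery_Upp, Entry.encl_ofEnds_snd] at h
  push_cast at h
  norm_num at h ⊢
  exact h

/-! ## §2 The best floor and the HIGH-TEMPERATURE-CLOSING window -/

/-- **BEST `T > 0` FLOOR = max(atomic, family)** on the whole box at εp = -59/5, every β ≥ 0: the atomic floor (full entropy, slope 43.7800) wins for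
β < β* ≈ 0.992 (T > 11700 K), the family floor `emeryBoxSLCOClass_pressureFloorFam_m59o5` (slope 44.6677, entropy ¼·log 2) for β > β*. [cite: Ruelle1969, §2.5–2.6] [cite: Israel1979, Lemma II.3.1] -/
theorem emeryBoxSLCOClass_pressureFloorBest_m59o5 {β : ℝ} (hβ : 0 ≤ β) :
    HoldsOn (fun p : EmeryCoord → ℝ => max (Real.log (atomicPartitionFnReal β (243/25 : ℝ) (459/50 : ℝ)) + 2 * Real.log (atomicPartitionFnReal β (63/10 : ℝ) (59/5 : ℝ))) (Real.log (Real.exp (-(β * (-178670811/1000000 : ℝ))) + Real.exp (-(β * (-88889929/500000 : ℝ)))) / 4) ≤ emeryCellPressure β (emeryLine cuprateSigns (emeryLineCoords (((-59/5 : ℚ)) : ℝ) p))) emeryBoxSLCOClass :=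
  fun p hp => max_le (emeryBoxSLCOClass_pressureAtomicFloor_m59o5 hβ p hp) (emeryBoxSLCOClass_pressureFloorFam_m59o5 hβ p hp)

/-- **THE HIGH-TEMPERATURE-CLOSING TWO-SIDED `T > 0` WINDOW** (hypothesis-free on both sides) on the whole `emeryBoxSLCOClass`, level εp = -59/5, EVERY β ≥ 0:
`max(atomic, family) ≤ P_cell ≤ 6 log 2 + β·966131563/20000000` (cap = `emeryBoxSLCOClass_pressureCap_m59o5_retilt`, hubbard-box-p1 re-tilted). BOTH SIDES EQUAL `6 log 2` AT β = 0; the width is `O(β)` for small β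
(slope gap 4.5266 against the atomic floor, 3.6389 against the family floor). Table [float; `T = 11604.5/β` K]:
| β (1/eV) | T (K) | atomic floor | family floor | best floor | cap | width |
|---|---|---|---|---|---|---|
| 0.01 | 1160450 | 4.4356 | 0.6189 | 4.4356 | 4.6419 | 0.2064 |
| 0.1 | 116045 | 7.2787 | 4.6292 | 7.2787 | 8.9895 | 1.7108 |
| 0.5 | 23209 | 23.1511 | 22.4576 | 23.1511 | 28.3122 | 5.1611 |
| 1 | 11604 | 44.7452 | 44.7536 | 44.7536 | 52.4655 | 7.7118 |
| 2 | 5802 | 88.4100 | 89.3743 | 89.3743 | 100.7720 | 11.3977 |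
| 5 | 2321 | 219.6262 | 223.3414 | 223.3414 | 245.6918 | 22.3504 |
| 10 | 1160 | 438.4954 | 446.6771 | 446.6771 | 487.2247 | 40.5476 |
| 20 | 580 | 876.2932 | 893.3541 | 893.3541 | 970.2904 | 76.9364 |
| 40 | 290 | 1751.8931 | 1786.7081 | 1786.7081 | 1936.4220 | 149.7139 |
[cite: Israel1979, Thm. I.2.4] [cite: Ruelle1969, §2.5–2.6] [cite: Ueltschi1999, §3] -/
theorem emeryBoxSLCOClass_pressureWindowHighT_m59o5 {β : ℝ} (hβ : 0 ≤ β) :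
    HoldsOn (fun p : EmeryCoord → ℝ =>
      max (Real.log (atomicPartitionFnReal β (243/25 : ℝ) (459/50 : ℝ)) + 2 * Real.log (atomicPartitionFnReal β (63/10 : ℝ) (59/5 : ℝ))) (Real.log (Real.exp (-(β * (-178670811/1000000 : ℝ))) + Real.exp (-(β * (-88889929/500000 : ℝ)))) / 4) ≤ emeryCellPressure β (emeryLine cuprateSigns (emeryLineCoords (((-59/5 : ℚ)) : ℝ) p)) ∧
      emeryCellPressure β (emeryLine cuprateSigns (emeryLineCoords (((-59/5 : ℚ)) : ℝ) p)) ≤ 6 * Real.log 2 + β * (966131563/20000000 : ℝ)) emeryBoxSLCOClass :=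
  fun p hp => ⟨emeryBoxSLCOClass_pressureFloorBest_m59o5 hβ p hp, by simpa using emeryBoxSLCOClass_pressureCap_m59o5_retilt hβ p hp⟩

/-- **At β = 0 the window is a point**: `P_cell(0, ·) = 6 log 2` on the whole box (floor and cap coincide). [cite: Ueltschi1999, §3] -/
theorem emeryBoxSLCOClass_pressure_beta_zero_m59o5 :
    HoldsOn (fun p : EmeryCoord → ℝ => emeryCellPressure 0 (emeryLine cuprateSigns (emeryLineCoords (((-59/5 : ℚ)) : ℝ) p)) = 6 * Real.log 2) emeryBoxSLCOClass := by
  intro p hp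
  have h := emeryBoxSLCOClass_pressureWindowHighT_m59o5 le_rfl p hp
  rw [atomicPartitionFnReal_beta_zero, atomicPartitionFnReal_beta_zero, show (4 : ℝ) = 2 ^ 2 by norm_num, Real.log_pow] at h
  push_cast at h
  have h1 := (le_max_left _ _).trans h.1
  linarith [h.2]

end Summit.Ventures.CertifiedManyBodySolver.Downfold

end
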